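import Summits.QuantumFields.QCD.Theorems.HeatSlicedQuarksQuarkLoopCoefficientSecondOrderExpansionAux
import Summits.QuantumFields.QCD.Theorems.HeatSlicedQuarksQuarkLoopCoefficientSecondOrderCoefficientAux

/-!
# Second-order expansion of the heat symbol — part B: vertex algebra
(line `Sketch` of crux stmt-QuantumFields-16786, stub `stub_secondOrderExpansion`, helper file)

* Entrywise bounds of spin-matrix products, of the generic weighted vertex
  `Σ_{v ∈ nbr2 0} Σ_{z ∈ nbr 0} c(z,v) • (ď♯(z) ď(v − z) f(w − v))`, of `vtx j` and of the cocycle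
  remainder coefficients.
* The free `D♯D` symbol `Σ_{z ∈ nbr 0} ď♯(z) ď(v − z) = sqKer 1 0 v` (translation invariance of the free
  Dirac kernel), and the expansions of the vertices `vtx 0`, `vtx 1`, `vtx 2` into the finite-support
  matrix kernels `η(v) = Σ_z (z∧v) ď♯(z)ď(v−z)`, `η'(v) = Σ_z (z∧v)² ď♯(z)ď(v−z)` and the Moyal weights
  `(v∧w)`, `(v∧w)²`.
* The first Moyal cancellation `Σ_v (v∧w) ĥ(v) k_r(w − v) = 0` (from the IBP identity of the free
  kernel) and the resulting collapsed form of `vtx 1 (pert0 r)`.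
-/

noncomputable section

namespace Summit.QuantumFields.QCD.Cruxes.QuarkLoopCoefficient.Sketch.SecondOrderExpansion

open Literature.MathematicalPhysics.QuantumLattice Literature.MathematicalPhysics.QuantumFieldTheory
open Literature.Probability.LatticeModels (Site)
open Summit.QuantumFields.QCD.Theorems.QuarkLoopCoefficient
open Summit.QuantumFields.QCD.Cruxes.QuarkLoopCoefficient.Sketch.HeatSeries
open Summit.QuantumFields.QCD.Cruxes.QuarkLoopCoefficient.Sketch.FreeMajorantToolkit
open scoped Matrix ComplexConjugate

/-! ## §4 Entrywise bounds of spin matrices and the generic weighted vertex -/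

/-- Entries of a product: `‖(A B)_{αβ}‖ ≤ 4 a b` for entry bounds `a`, `b`. -/
theorem norm_mul_apply_le {A B : Spin} {a b : ℝ} (hA : ∀ α β, ‖A α β‖ ≤ a) (hB : ∀ α β, ‖B α β‖ ≤ b)
    (α β : Fin 4) : ‖(A * B) α β‖ ≤ 4 * a * b := by
  rw [Matrix.mul_apply]
  refine (norm_sum_le _ _).trans ?_
  have ha : 0 ≤ a := (norm_nonneg _).trans (hA α α)
  calc ∑ γ : Fin 4, ‖A α γ * B γ β‖ ≤ ∑ _γ : Fin 4, a * b := Finset.sum_le_sum fun γ _ => by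
        rw [norm_mul]; exact mul_le_mul (hA α γ) (hB γ β) (norm_nonneg _) ha
    _ = 4 * a * b := by simp; ring

/-- Entries of a scalar multiple. -/
theorem norm_smul_apply_le {A : Spin} {a : ℝ} (c : ℂ) (hA : ∀ α β, ‖A α β‖ ≤ a) (α β : Fin 4) :
    ‖(c • A) α β‖ ≤ ‖c‖ * a := by
  rw [Matrix.smul_apply, smul_eq_mul, norm_mul]
  exact mul_le_mul_of_nonneg_left (hA α β) (norm_nonneg c)

/-- Entries of the identity are bounded by one. -/
theorem norm_one_apply_le (α β : Fin 4) : ‖(1 : Spin) α β‖ ≤ 1 := by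
  rw [Matrix.one_apply]; split_ifs <;> simp

/-- Entries of the free Dirac symbol are bounded by `12`. -/
theorem norm_dsymb_apply_le (w : Site 4) (α β : Fin 4) : ‖dsymb w α β‖ ≤ 12 :=
  norm_diracKer_le (u := fun _ => (1 : ℂ)) (fun _ => by simp) 0 w α β

/-- Entries of the adjoint symbol are bounded by `12`. -/
theorem norm_dsharp_apply_le (z : Site 4) (α β : Fin 4) : ‖dsharp z α β‖ ≤ 12 := by
  unfold dsharp
  rw [Matrix.conjTranspose_apply, norm_star]
  exact norm_dsymb_apply_le _ _ _

/-- The elementary vertex block: `‖(ď♯(z) ď(y) M)_{αβ}‖ ≤ 2304 F` if the entries of `M` are `≤ F`. -/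
theorem norm_dsharp_mul_dsymb_mul_apply_le {M : Spin} {F : ℝ} (hM : ∀ α β, ‖M α β‖ ≤ F)
    (z y : Site 4) (α β : Fin 4) : ‖(dsharp z * dsymb y * M) α β‖ ≤ 2304 * F := by
  have h1 : ∀ α β, ‖(dsharp z * dsymb y) α β‖ ≤ 4 * 12 * 12 := fun α β =>
    norm_mul_apply_le (norm_dsharp_apply_le z) (norm_dsymb_apply_le y) α β
  have := norm_mul_apply_le h1 hM α β
  linarith

/-- **Generic weighted vertex bound.**  For coefficients `c(z, v)` bounded by `K ≥ 0` on
`nbr 0 × nbr2 0` and a field `f` with entries `‖f(y)_{γδ}‖ ≤ F(y)`,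
`‖(Σ_{v ∈ nbr2 0} Σ_{z ∈ nbr 0} c(z,v) • (ď♯(z) ď(v−z) f(w−v)))_{αβ}‖ ≤ 20736 K Σ_{v ∈ nbr2 0} F(w − v)`. -/
theorem norm_weightedVertex_apply_le {c : Site 4 → Site 4 → ℂ} {K : ℝ} {f : Site 4 → Spin}
    {F : Site 4 → ℝ} (hK : 0 ≤ K) (hc : ∀ z ∈ nbr 0, ∀ v ∈ nbr2 0, ‖c z v‖ ≤ K)
    (hF : ∀ y α β, ‖f y α β‖ ≤ F y) (w : Site 4) (α β : Fin 4) :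
    ‖(∑ v ∈ nbr2 0, ∑ z ∈ nbr 0, c z v • (dsharp z * dsymb (v - z) * f (w - v))) α β‖ ≤
      20736 * K * ∑ v ∈ nbr2 0, F (w - v) := by
  rw [Matrix.sum_apply, Finset.mul_sum]
  refine (norm_sum_le _ _).trans (Finset.sum_le_sum fun v hv => ?_)
  rw [Matrix.sum_apply]
  refine (norm_sum_le _ _).trans ?_
  have hFv : 0 ≤ F (w - v) := (norm_nonneg _).trans (hF (w - v) α α)
  have hterm : ∀ z ∈ nbr 0, ‖(c z v • (dsharp z * dsymb (v - z) * f (w - v))) α β‖ ≤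
      K * (2304 * F (w - v)) := fun z hz =>
    (norm_smul_apply_le (c z v) (norm_dsharp_mul_dsymb_mul_apply_le (hF (w - v)) z (v - z)) α β).trans
      (mul_le_mul_of_nonneg_right (hc z hz v hv) (by positivity))
  calc ∑ z ∈ nbr 0, ‖(c z v • (dsharp z * dsymb (v - z) * f (w - v))) α β‖
      ≤ ∑ _z ∈ nbr 0, K * (2304 * F (w - v)) := Finset.sum_le_sum hterm
    _ = (nbr 0).card * (K * (2304 * F (w - v))) := by rw [Finset.sum_const, nsmul_eq_mul]
    _ ≤ 9 * (K * (2304 * F (w - v))) := by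
        have := card_nbr_le (0 : Site 4)
        exact mul_le_mul_of_nonneg_right (by exact_mod_cast this) (by positivity)
    _ = 20736 * K * F (w - v) := by ring

/-- The vertex coefficient of order `j`: `‖((i/2)(z∧v + v∧w))ʲ/j!‖ ≤ (2(1 + |w|))ʲ`. -/
theorem norm_vtxCoeff_le {z v : Site 4} (hz : z ∈ nbr 0) (hv : v ∈ nbr2 0) (w : Site 4) (j : ℕ) :
    ‖(Complex.I / 2 * ((wedge z v + wedge v w : ℤ) : ℂ)) ^ j / (j.factorial : ℂ)‖ ≤
      (2 * (1 + elen w)) ^ j := by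
  rw [norm_div, norm_pow, norm_mul, norm_div, Complex.norm_I, Complex.norm_natCast]
  have hn : ‖((wedge z v + wedge v w : ℤ) : ℂ)‖ ≤ 4 * (1 + elen w) := by
    rw [← Complex.ofReal_intCast, Complex.norm_real, Real.norm_eq_abs]
    exact abs_wedge_add_wedge_le hz hv w
  have hfac : (1 : ℝ) ≤ (j.factorial : ℝ) := by exact_mod_cast Nat.one_le_iff_ne_zero.mpr (Nat.factorial_ne_zero j)
  calc (1 / ‖(2 : ℂ)‖ * ‖((wedge z v + wedge v w : ℤ) : ℂ)‖) ^ j / (j.factorial : ℝ)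
      ≤ (1 / ‖(2 : ℂ)‖ * ‖((wedge z v + wedge v w : ℤ) : ℂ)‖) ^ j / 1 :=
        div_le_div_of_nonneg_left (by positivity) one_pos hfac
    _ = (1 / 2 * ‖((wedge z v + wedge v w : ℤ) : ℂ)‖) ^ j := by simp
    _ ≤ (1 / 2 * (4 * (1 + elen w))) ^ j := by gcongr
    _ = (2 * (1 + elen w)) ^ j := by ring

/-- **Entry bound of the order-`j` vertex**:
`‖(vtx j f w)_{αβ}‖ ≤ 20736 (2(1+|w|))ʲ Σ_{v ∈ nbr2 0} F(w − v)`. -/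
theorem norm_vtx_apply_le {f : Site 4 → Spin} {F : Site 4 → ℝ} (hF : ∀ y α β, ‖f y α β‖ ≤ F y)
    (j : ℕ) (w : Site 4) (α β : Fin 4) :
    ‖vtx j f w α β‖ ≤ 20736 * (2 * (1 + elen w)) ^ j * ∑ v ∈ nbr2 0, F (w - v) := by
  unfold vtx
  have he := elen_nonneg w
  exact norm_weightedVertex_apply_le (c := fun z v =>
    (Complex.I / 2 * ((wedge z v + wedge v w : ℤ) : ℂ)) ^ j / (j.factorial : ℂ))
    (by positivity) (fun z hz v hv => norm_vtxCoeff_le hz hv w j) hF w α β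

/-- The cocycle remainder coefficient of order `m`:
`‖e^{i(θ/2)(z∧v+v∧w)} − Σ_{j<m} θʲ((i/2)(z∧v+v∧w))ʲ/j!‖ ≤ (2|θ|(1+|w|))ᵐ`. -/
theorem norm_cocycleRemainder_le {z v : Site 4} (hz : z ∈ nbr 0) (hv : v ∈ nbr2 0) (θ : ℝ) (w : Site 4)
    (m : ℕ) :
    ‖Complex.exp (((θ / 2 * (wedge z v + wedge v w : ℤ) : ℝ) : ℂ) * Complex.I) -
        ∑ j ∈ Finset.range m, (θ : ℂ) ^ j *
          ((Complex.I / 2 * ((wedge z v + wedge v w : ℤ) : ℂ)) ^ j / (j.factorial : ℂ))‖ ≤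
      (2 * |θ| * (1 + elen w)) ^ m := by
  have hterm : ∀ j : ℕ, (θ : ℂ) ^ j * ((Complex.I / 2 * ((wedge z v + wedge v w : ℤ) : ℂ)) ^ j /
      (j.factorial : ℂ)) = (((θ / 2 * (wedge z v + wedge v w : ℤ) : ℝ) : ℂ) * Complex.I) ^ j /
        (j.factorial : ℂ) := by
    intro j
    rw [mul_div_assoc', ← mul_pow]
    congr 2
    push_cast; ring
  simp_rw [hterm]
  refine (norm_cexp_mul_I_sub_sum_le m _).trans ?_
  have h := abs_wedge_add_wedge_le hz hv w
  have : |θ / 2 * ((wedge z v + wedge v w : ℤ) : ℝ)| ≤ 2 * |θ| * (1 + elen w) := by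
    rw [abs_mul, abs_div, abs_two]
    calc |θ| / 2 * |((wedge z v + wedge v w : ℤ) : ℝ)| ≤ |θ| / 2 * (4 * (1 + elen w)) := by gcongr
      _ = 2 * |θ| * (1 + elen w) := by ring
  exact pow_le_pow_left₀ (abs_nonneg _) this m

/-! ## §5 The free symbol and the vertex expansions -/

/-- The flux-free symmetric-gauge field is the trivial field. -/
theorem symLink_zero_eq : symLink 0 = fun _ => (1 : ℂ) := by
  funext e
  simp [symLink]

/-- **The free `D♯D` symbol**: `Σ_{z ∈ nbr 0} ď♯(z) ď(v − z) = sqKer 1 0 v` (translation invariance of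
the free Dirac kernel, `SecondOrderCoefficient.diracKer_one_translate`). -/
theorem sum_dsharp_mul_dsymb_eq_sqKer (v : Site 4) :
    ∑ z ∈ nbr 0, dsharp z * dsymb (v - z) = sqKer (fun _ => (1 : ℂ)) 0 v := by
  unfold sqKer dsharp dsymb
  refine Finset.sum_congr rfl fun z _ => ?_
  rw [← SecondOrderCoefficient.diracKer_one_translate 0 (-z) z,
    ← SecondOrderCoefficient.diracKer_one_translate 0 (v - z) z, zero_add, neg_add_cancel, sub_add_cancel]

/-- Pulling a right factor and scalar weights out of the `z`-sum of the vertex. -/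
theorem sum_smul_mul_mul (a : Site 4 → ℂ) (v : Site 4) (F : Spin) :
    ∑ z ∈ nbr 0, a z • (dsharp z * dsymb (v - z) * F) =
      (∑ z ∈ nbr 0, a z • (dsharp z * dsymb (v - z))) * F := by
  rw [Finset.sum_mul]
  refine Finset.sum_congr rfl fun z _ => ?_
  rw [smul_mul_assoc]

/-- **The order-zero vertex** is the free convolution with the symbol `ď♯ ⋆ ď`:
`vtx 0 f w = Σ_v sqKer 1 0 v * f(w − v)`. -/
theorem vtx_zero_apply (f : Site 4 → Spin) (w : Site 4) :
    vtx 0 f w = ∑ v ∈ nbr2 0, sqKer (fun _ => (1 : ℂ)) 0 v * f (w - v) := by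
  unfold vtx
  refine Finset.sum_congr rfl fun v _ => ?_
  simp only [pow_zero, Nat.factorial_zero, Nat.cast_one, div_one, one_smul]
  rw [← sum_dsharp_mul_dsymb_eq_sqKer, Finset.sum_mul]

/-- **The order-one vertex**: `vtx 1 f w = Σ_v (i/2) • (η(v) f(w−v)) + Σ_v (i/2)(v∧w) • (ȟ₀(v) f(w−v))`
with `η(v) = Σ_z (z∧v) • ď♯(z)ď(v−z)` and `ȟ₀(v) = sqKer 1 0 v`. -/
theorem vtx_one_apply (f : Site 4 → Spin) (w : Site 4) :
    vtx 1 f w =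
      ∑ v ∈ nbr2 0, (Complex.I / 2) •
          ((∑ z ∈ nbr 0, ((wedge z v : ℤ) : ℂ) • (dsharp z * dsymb (v - z))) * f (w - v)) +
        ∑ v ∈ nbr2 0, (Complex.I / 2 * ((wedge v w : ℤ) : ℂ)) •
          (sqKer (fun _ => (1 : ℂ)) 0 v * f (w - v)) := by
  unfold vtx
  rw [← Finset.sum_add_distrib]
  refine Finset.sum_congr rfl fun v _ => ?_
  simp only [pow_one, Nat.factorial_one, Nat.cast_one, div_one, Int.cast_add]
  have hsplit : ∀ z : Site 4, (Complex.I / 2 * (((wedge z v : ℤ) : ℂ) + ((wedge v w : ℤ) : ℂ))) •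
      (dsharp z * dsymb (v - z) * f (w - v)) =
        (Complex.I / 2) • (((wedge z v : ℤ) : ℂ) • (dsharp z * dsymb (v - z) * f (w - v))) +
          (Complex.I / 2 * ((wedge v w : ℤ) : ℂ)) • (dsharp z * dsymb (v - z) * f (w - v)) := by
    intro z; rw [mul_add, add_smul, smul_smul]
  simp only [hsplit, Finset.sum_add_distrib, ← Finset.smul_sum]
  congr 1
  · rw [sum_smul_mul_mul]
  · rw [← Finset.sum_mul, sum_dsharp_mul_dsymb_eq_sqKer]

/-- **The order-two vertex**:
`vtx 2 f w = Σ_v (−1/8) • (η'(v) f) + Σ_v (−(v∧w)/4) • (η(v) f) + Σ_v (−(v∧w)²/8) • (ȟ₀(v) f)`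
with `η'(v) = Σ_z (z∧v)² • ď♯(z)ď(v−z)`. -/
theorem vtx_two_apply (f : Site 4 → Spin) (w : Site 4) :
    vtx 2 f w =
      ∑ v ∈ nbr2 0, (-1 / 8 : ℂ) •
          ((∑ z ∈ nbr 0, (((wedge z v : ℤ) : ℂ) ^ 2) • (dsharp z * dsymb (v - z))) * f (w - v)) +
        ∑ v ∈ nbr2 0, (-1 / 4 * ((wedge v w : ℤ) : ℂ)) •
          ((∑ z ∈ nbr 0, ((wedge z v : ℤ) : ℂ) • (dsharp z * dsymb (v - z))) * f (w - v)) +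
        ∑ v ∈ nbr2 0, (-1 / 8 * ((wedge v w : ℤ) : ℂ) ^ 2) •
          (sqKer (fun _ => (1 : ℂ)) 0 v * f (w - v)) := by
  unfold vtx
  rw [← Finset.sum_add_distrib, ← Finset.sum_add_distrib]
  refine Finset.sum_congr rfl fun v _ => ?_
  simp only [Int.cast_add, Nat.factorial_two, Nat.cast_ofNat]
  have hsplit : ∀ z : Site 4,
      ((Complex.I / 2 * (((wedge z v : ℤ) : ℂ) + ((wedge v w : ℤ) : ℂ))) ^ 2 / 2) •
        (dsharp z * dsymb (v - z) * f (w - v)) =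
      (-1 / 8 : ℂ) • ((((wedge z v : ℤ) : ℂ) ^ 2) • (dsharp z * dsymb (v - z) * f (w - v))) +
        (-1 / 4 * ((wedge v w : ℤ) : ℂ)) • (((wedge z v : ℤ) : ℂ) • (dsharp z * dsymb (v - z) * f (w - v))) +
        (-1 / 8 * ((wedge v w : ℤ) : ℂ) ^ 2) • (dsharp z * dsymb (v - z) * f (w - v)) := by
    intro z
    rw [smul_smul, smul_smul, ← add_smul, ← add_smul]
    congr 1
    have hI : Complex.I ^ 2 = -1 := Complex.I_sq
    field_simp
    ring_nf
    rw [hI]; ring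
  simp only [hsplit, Finset.sum_add_distrib, ← Finset.smul_sum]
  congr 2
  · rw [sum_smul_mul_mul]
  · rw [sum_smul_mul_mul]
  · rw [← Finset.sum_mul, sum_dsharp_mul_dsymb_eq_sqKer]

/-! ## §6 The first Moyal cancellation -/

/-- **First Moyal cancellation**: `Σ_{v ∈ nbr2 0} (v∧w) ĥ(v) k_r(w − v) = 0` for `r ≥ 0`, from the IBP
identity (6) of `FreeHeatCalculus` (for `r > 0`) and `k_0 = δ` (for `r = 0`). -/
theorem sum_wedge_mul_hhat_mul_freeKer_eq_zero
    (h3 : ∀ w : Site 4, freeKer 0 w = if w = 0 then 1 else 0)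
    (h6 : ∀ t : ℝ, 0 ≤ t → ∀ (w : Site 4) (ν : Fin 4),
      t * (∑ z ∈ nbr2 0, ((z ν : ℤ) : ℝ) * hhat z * freeKer t (w - z)) + ((w ν : ℤ) : ℝ) * freeKer t w = 0)
    {r : ℝ} (hr : 0 ≤ r) (w : Site 4) :
    ∑ v ∈ nbr2 0, ((wedge v w : ℤ) : ℝ) * hhat v * freeKer r (w - v) = 0 := by
  rcases hr.eq_or_lt with h0 | hpos
  · -- `r = 0`: `k_0 = δ` and `w ∧ w = 0`
    rw [← h0]
    refine Finset.sum_eq_zero fun v _ => ?_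
    rw [h3]
    split_ifs with hv
    · have : v = w := (sub_eq_zero.mp hv).symm
      rw [this, cast_wedge]; ring
    · rw [mul_zero]
  · -- `r > 0`: `r · M = w₁ (−w₀ k) − w₀ (−w₁ k) = 0`
    have e0 := h6 r hr w 0
    have e1 := h6 r hr w 1
    have key : r * ∑ v ∈ nbr2 0, ((wedge v w : ℤ) : ℝ) * hhat v * freeKer r (w - v) = 0 := by
      have hexp : ∑ v ∈ nbr2 0, ((wedge v w : ℤ) : ℝ) * hhat v * freeKer r (w - v) =
          ((w 1 : ℤ) : ℝ) * ∑ v ∈ nbr2 0, ((v 0 : ℤ) : ℝ) * hhat v * freeKer r (w - v) -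
            ((w 0 : ℤ) : ℝ) * ∑ v ∈ nbr2 0, ((v 1 : ℤ) : ℝ) * hhat v * freeKer r (w - v) := by
        rw [Finset.mul_sum, Finset.mul_sum, ← Finset.sum_sub_distrib]
        refine Finset.sum_congr rfl fun v _ => ?_
        rw [cast_wedge]; ring
      rw [hexp]
      have : r * (((w 1 : ℤ) : ℝ) * ∑ v ∈ nbr2 0, ((v 0 : ℤ) : ℝ) * hhat v * freeKer r (w - v) -
          ((w 0 : ℤ) : ℝ) * ∑ v ∈ nbr2 0, ((v 1 : ℤ) : ℝ) * hhat v * freeKer r (w - v)) =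
          ((w 1 : ℤ) : ℝ) * (r * ∑ v ∈ nbr2 0, ((v 0 : ℤ) : ℝ) * hhat v * freeKer r (w - v)) -
            ((w 0 : ℤ) : ℝ) * (r * ∑ v ∈ nbr2 0, ((v 1 : ℤ) : ℝ) * hhat v * freeKer r (w - v)) := by
        ring
      rw [this]
      have f0 : r * ∑ v ∈ nbr2 0, ((v 0 : ℤ) : ℝ) * hhat v * freeKer r (w - v) =
          -(((w 0 : ℤ) : ℝ) * freeKer r w) := by linarith
      have f1 : r * ∑ v ∈ nbr2 0, ((v 1 : ℤ) : ℝ) * hhat v * freeKer r (w - v) =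
          -(((w 1 : ℤ) : ℝ) * freeKer r w) := by linarith
      rw [f0, f1]; ring
    rcases mul_eq_zero.mp key with h | h
    · exact absurd h hpos.ne'
    · exact h

/-- Complex form of the Moyal cancellation, with the weights as used in the vertices. -/
theorem sum_wedge_smul_hhat_freeKer_eq_zero
    (h3 : ∀ w : Site 4, freeKer 0 w = if w = 0 then 1 else 0)
    (h6 : ∀ t : ℝ, 0 ≤ t → ∀ (w : Site 4) (ν : Fin 4),
      t * (∑ z ∈ nbr2 0, ((z ν : ℤ) : ℝ) * hhat z * freeKer t (w - z)) + ((w ν : ℤ) : ℝ) * freeKer t w = 0)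
    {r : ℝ} (hr : 0 ≤ r) (w : Site 4) (c : ℂ) :
    ∑ v ∈ nbr2 0, (c * ((wedge v w : ℤ) : ℂ)) •
        (((hhat v : ℝ) : ℂ) • ((freeKer r (w - v) : ℝ) : ℂ) • (1 : Spin)) = 0 := by
  have h := sum_wedge_mul_hhat_mul_freeKer_eq_zero h3 h6 hr w
  have hterm : ∀ v : Site 4, (c * ((wedge v w : ℤ) : ℂ)) •
      (((hhat v : ℝ) : ℂ) • ((freeKer r (w - v) : ℝ) : ℂ) • (1 : Spin)) =
      c • (((((wedge v w : ℤ) : ℝ) * hhat v * freeKer r (w - v) : ℝ) : ℂ) • (1 : Spin)) := by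
    intro v
    rw [smul_smul, smul_smul, smul_smul]
    congr 1
    push_cast; ring
  simp_rw [hterm]
  rw [← Finset.smul_sum, ← Finset.sum_smul, ← Complex.ofReal_sum, h]
  simp

/-- **Collapsed first-order vertex on the free kernel**: the Moyal part drops out,
`vtx 1 (pert0 r) w = Σ_v ((i/2) k_r(w − v)) • η(v)` for `r ≥ 0`. -/
theorem vtx_one_pert0
    (h1 : ∀ x y : Site 4, sqKer (fun _ => (1 : ℂ)) x y = ((hhat (y - x) : ℝ) : ℂ) • (1 : Spin))
    (h3 : ∀ w : Site 4, freeKer 0 w = if w = 0 then 1 else 0)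
    (h6 : ∀ t : ℝ, 0 ≤ t → ∀ (w : Site 4) (ν : Fin 4),
      t * (∑ z ∈ nbr2 0, ((z ν : ℤ) : ℝ) * hhat z * freeKer t (w - z)) + ((w ν : ℤ) : ℝ) * freeKer t w = 0)
    {r : ℝ} (hr : 0 ≤ r) (w : Site 4) :
    vtx 1 (pert0 r) w = ∑ v ∈ nbr2 0, (Complex.I / 2 * ((freeKer r (w - v) : ℝ) : ℂ)) •
      ∑ z ∈ nbr 0, ((wedge z v : ℤ) : ℂ) • (dsharp z * dsymb (v - z)) := by
  rw [vtx_one_apply]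
  have hmoyal : ∑ v ∈ nbr2 0, (Complex.I / 2 * ((wedge v w : ℤ) : ℂ)) •
      (sqKer (fun _ => (1 : ℂ)) 0 v * pert0 r (w - v)) = 0 := by
    have : ∀ v : Site 4, sqKer (fun _ => (1 : ℂ)) 0 v * pert0 r (w - v) =
        ((hhat v : ℝ) : ℂ) • ((freeKer r (w - v) : ℝ) : ℂ) • (1 : Spin) := by
      intro v
      rw [h1, sub_zero, pert0, Matrix.smul_mul, Matrix.one_mul]
    simp_rw [this]
    exact sum_wedge_smul_hhat_freeKer_eq_zero h3 h6 hr w _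
  rw [hmoyal, add_zero]
  refine Finset.sum_congr rfl fun v _ => ?_
  rw [pert0, Matrix.mul_smul, Matrix.mul_one, smul_smul]

/-! ## Registered headline -/

/-- Registered headline of this helper file (aux stub `stub_secondOrderExpansionAuxB` of crux
stmt-QuantumFields-16786, line `Sketch`): the free `D♯D` symbol as the twisted product at zero flux. -/
theorem stub_secondOrderExpansionAuxB : ∀ (v : Site 4), ∑ z ∈ nbr 0, dsharp z * dsymb (v - z) = sqKer (fun _ => (1 : ℂ)) 0 v :=
  sum_dsharp_mul_dsymb_eq_sqKer

end Summit.QuantumFields.QCD.Cruxes.QuarkLoopCoefficient.Sketch.SecondOrderExpansion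

end
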